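import Summits.QuantumAdvantage.QuantumAdvantage.Theorems.CharDialMaskDialA
import Summits.QuantumAdvantage.QuantumAdvantage.Theorems.CharDialNullDialB
import Mathlib.FieldTheory.Finite.GaloisField
import HarnessLib
import Summits.QuantumAdvantage.QuantumAdvantage.Theorems.CharDialMaskDialF
import Summits.QuantumAdvantage.QuantumAdvantage.Theorems.CharDialFlipCount

/-!
# CharDial / JLinPeel — FIELD COLUMNS, part A: the family `fieldY` (route `CharDial`, item 32604; lens-6 node g18 §10)

The first strategy family that no junta ⊕ one-form presentation with `log₂ n`-juntas brings under the (inlined) hypothesis of the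
fifth peel (the mask dial of parts 31C–31F; hence of the block and null dials, which it contains for `3 ∤ p`).

* COLUMNS.  `F = GaloisField p R`, `R = rk n = (log₂ n + 1)²`, with the `𝔽_p`-basis `basisGF`; the POWER COLUMN `pcol α r i =
  coord_r (α^(i+1))`.  A set `B` of coordinates is zero-sum for the columns `r < R'` iff the power sum `Σ_{i∈B} α^(i+1)` has
  vanishing coordinates `r < R'`.
* FAMILY `fieldY p n α`: cut `g` is the junta-free form-acceptance test `[g ≡ a_g·u (mod p)]` with `a_g = ` the `resY`-type
  prefix/tail pattern (prefix cut-off `p·(g/p)`, separator `NullDial.sepM`) filled with the power column of index `(g/p) mod R`.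
  The cuts `g = p·j`, `j ≥ sepM`, are FULL-PATTERN (`a_g = pcol α (j mod R)`) and accept `u = 0`.
* `flip_zero`, `flipCount_zero` — the flip criterion / flip count of part 31K for cuts accepting `u = 0` (no richness hypothesis),
  `card_blocks_le` (`M` separated non-empty masked blocks force `M ≤ n`).
* the FULL-PATTERN cuts `gcut r = p · jcut r` (`jcut r ≡ r (mod R+1)`, `jcut r ≥ sepM`, fits once `3·p·(R+1) ≤ n`): `fieldY_gcut` —
  at them the strategy is the `u = 0`-accepting test of the power column `r`.

Part B (CharDialFieldColB) proves: genericity of `α` ⇒ robust mask escape (`field_not_mask`), generic `α` exist by counting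
(`exists_generic`), hence ★★ `fieldY_not_mask` / `fieldY_not_mask_eventually`.
-/


set_option autoImplicit false

namespace Summit.QuantumAdvantage.AdviceFreeQNC0.JLinPeel.FieldCol

open Finset MaskDial BlockDial Polynomial

/-! #### (0) flip criterion and flip count for cuts accepting `u = 0` -/
section FlipZero
variable {p n : ℕ}

/-- **flip criterion, base point `u = 0`**: cut `g` is canonically the junta-free test `[0 = a·u]`; a set `W` missing the presented
junta of `g` with presented zero-sum is canonically zero-sum. -/
theorem flip_zero (D : JLinData p n) (g : Fin (n + 1)) (a : Fin n → ZMod p)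
    (hy : ∀ u, D.strat g u = decide ((0 : ZMod p) = ∑ i, if u i then a i else 0))
    (W : Finset (Fin n)) (hWJ : ∀ i ∈ W, i ∉ D.J g) (hsum : ∑ i ∈ W, D.a g i = 0) :
    ∑ i ∈ W, a i = 0 := by
  classical
  set u0 : Fin n → Bool := fun _ => false with hu0
  set u1 : Fin n → Bool := fun i => decide (i ∈ W) with hu1
  have hform0 : D.form g u0 = 0 := by simp [JLinData.form, u0]
  have hform1 : D.form g u1 = 0 := by rw [hu1, Summit.QuantumAdvantage.AdviceFreeQNC0.JLinPeel.FlipCount.form_indicator, hsum]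
  have hagree : ∀ i ∈ D.J g, u0 i = u1 i := by
    intro i hi
    have hiW : i ∉ W := fun hW => hWJ i hW hi
    simp [u0, u1, hiW]
  have hpres : D.strat g u0 = D.strat g u1 := by
    show D.h g u0 (D.form g u0) = D.h g u1 (D.form g u1)
    rw [hform0, hform1, D.hJ g u0 u1 hagree]
  rw [hy u0, hy u1, hu1, Summit.QuantumAdvantage.AdviceFreeQNC0.JLinPeel.MaskDial.ite_mem_sum] at hpres
  have h0 : decide ((0 : ZMod p) = ∑ i, if u0 i then a i else 0) = true := by simp [u0]
  rw [h0] at hpres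
  exact ((decide_eq_true_eq.mp hpres.symm)).symm

/-- **flip count, base point `u = 0`**: the inlined mask hypothesis for `D` (juntas `≤ L`) and `R` canonical columns of
`u = 0`-accepting form cuts with `R·L < M` give a masked block zero-sum for ALL `R` columns. -/
theorem flipCount_zero (D : JLinData p n) {L : ℕ} (hJ : ∀ g, (D.J g).card ≤ L)
    {R : ℕ} (col : Fin R → Fin n → ZMod p) (gr : Fin R → Fin (n + 1))
    (hy : ∀ r u, D.strat (gr r) u = decide ((0 : ZMod p) = ∑ i, if u i then col r i else 0))
    {ℓ M : ℕ} {S : Fin M → ℕ} {Z : Finset (Fin n)}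
    (hS : (∀ k k' : Fin M, k < k' → S k + ℓ ≤ S k') ∧ (∀ k : Fin M, S k + ℓ ≤ n))
    (hmask : ∀ g (k : Fin M), ∑ i ∈ zblk ℓ S Z k, D.a g i = 0) (hRL : R * L < M) :
    ∃ k : Fin M, ∀ r, ∑ i ∈ zblk ℓ S Z k, col r i = 0 := by
  obtain ⟨k, hk⟩ := Summit.QuantumAdvantage.AdviceFreeQNC0.JLinPeel.FlipCount.exists_block_free_all (fun k => zblk ℓ S Z k) (fun k k' hne => Summit.QuantumAdvantage.AdviceFreeQNC0.JLinPeel.FlipCount.zblk_disjoint_ne hS k k' hne)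
    (fun r => D.J (gr r)) (fun r => hJ (gr r)) hRL
  exact ⟨k, fun r => flip_zero D (gr r) (col r) (hy r) _ (hk r) (hmask (gr r) k)⟩

/-- `M` separated masked blocks of size `m ≥ 1` force `M ≤ n`. -/
theorem card_blocks_le {M ℓ m : ℕ} {S : Fin M → ℕ} {Z : Finset (Fin n)}
    (hS : (∀ k k' : Fin M, k < k' → S k + ℓ ≤ S k') ∧ (∀ k : Fin M, S k + ℓ ≤ n))
    (hm : ∀ k : Fin M, (zblk (n := n) ℓ S Z k).card = m) (hm1 : 1 ≤ m) : M ≤ n := by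
  classical
  have hdisj : Set.PairwiseDisjoint (↑(univ : Finset (Fin M))) (zblk (n := n) ℓ S Z) :=
    fun k _ k' _ hne => Summit.QuantumAdvantage.AdviceFreeQNC0.JLinPeel.FlipCount.zblk_disjoint_ne hS k k' hne
  have h1 : (univ.biUnion (zblk (n := n) ℓ S Z)).card = ∑ k : Fin M, (zblk (n := n) ℓ S Z k).card := card_biUnion hdisj
  have h2 : (univ.biUnion (zblk (n := n) ℓ S Z)).card ≤ n := le_trans (card_le_univ _) (by simp)
  rw [h1] at h2
  have h3 : ∑ k : Fin M, (zblk (n := n) ℓ S Z k).card = M * m := by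
    rw [Finset.sum_congr rfl fun k _ => hm k]; simp
  rw [h3] at h2
  nlinarith

end FlipZero

/-! #### (1) the field, its basis coordinates, the power columns -/
section Columns
variable (p : ℕ) [hp : Fact p.Prime]

/-- the number of columns `R = (log₂ n + 1)²` (also the degree of the field). -/
def rk (n : ℕ) : ℕ := (Nat.log 2 n + 1) ^ 2

/-- `rk n ≠ 0`. -/
theorem rk_ne_zero (n : ℕ) : rk n ≠ 0 := pow_ne_zero 2 (Nat.succ_ne_zero _)

/-- `rk n` is positive. -/
theorem rk_pos (n : ℕ) : 0 < rk n := Nat.pos_of_ne_zero (rk_ne_zero n)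

/-- an `𝔽_p`-basis of `GaloisField p (rk n)` indexed by `Fin (rk n)`. -/
noncomputable def basisGF (n : ℕ) : Module.Basis (Fin (rk n)) (ZMod p) (GaloisField p (rk n)) :=
  Module.finBasisOfFinrankEq _ _ (GaloisField.finrank p (rk_ne_zero n))

/-- coordinate `r` of a field element. -/
noncomputable def coord (n : ℕ) (x : GaloisField p (rk n)) (r : Fin (rk n)) : ZMod p := (basisGF p n).repr x r

/-- coordinates are additive over finite sums. -/
theorem coord_sum (n : ℕ) {ι : Type*} (s : Finset ι) (f : ι → GaloisField p (rk n)) (r : Fin (rk n)) :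
    coord p n (∑ i ∈ s, f i) r = ∑ i ∈ s, coord p n (f i) r := by
  unfold coord
  rw [map_sum, Finsupp.finsetSum_apply]

/-- equal coordinates ⇒ equal elements. -/
theorem eq_of_coord_eq (n : ℕ) {x y : GaloisField p (rk n)} (h : ∀ r, coord p n x r = coord p n y r) : x = y := by
  apply (basisGF p n).repr.injective
  ext r
  exact h r

/-- the POWER COLUMN of index `r`: coordinate `r` of `α^(i+1)`. -/
noncomputable def pcol (n : ℕ) (α : GaloisField p (rk n)) (r : Fin (rk n)) (i : Fin n) : ZMod p :=
  coord p n (α ^ (i.val + 1)) r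

/-- the COLUMN TABLE of the family: the `R` power columns and, at index `R`, the CONSTANT column `1` (the counting cut; it is
what the rank/sparse escapes of node §10.4 (c)(d) will use — all its coefficients are non-zero). -/
noncomputable def col (n : ℕ) (α : GaloisField p (rk n)) (r : Fin (rk n + 1)) (i : Fin n) : ZMod p :=
  if h : r.val < rk n then pcol p n α ⟨r.val, h⟩ i else 1

/-- the power columns inside the table. -/
theorem col_cast (n : ℕ) (α : GaloisField p (rk n)) (r : Fin (rk n)) (i : Fin n) :
    col p n α ⟨r.val, Nat.lt_succ_of_lt r.isLt⟩ i = pcol p n α r i := by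
  unfold col
  rw [dif_pos r.isLt]

/-- a set is zero-sum for the power column `r` iff coordinate `r` of its power sum vanishes. -/
theorem pcol_sum (n : ℕ) (α : GaloisField p (rk n)) (r : Fin (rk n)) (B : Finset (Fin n)) :
    ∑ i ∈ B, pcol p n α r i = coord p n (∑ i ∈ B, α ^ (i.val + 1)) r := by
  unfold pcol
  rw [coord_sum]

end Columns

/-! #### (2) the family `fieldY` and its canonical presentation -/
section Family
variable (p : ℕ) [hp : Fact p.Prime]

/-- canonical coefficient vector of a cut with prefix parameter `q` and column `r`: the `resY` prefix/tail pattern filled with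
the power column. -/
noncomputable def fieldCoef (n : ℕ) (α : GaloisField p (rk n)) (q : ℕ) (r : Fin (rk n + 1)) : Fin n → ZMod p := fun i =>
  if i.val < p * NullDial.sepM p n then (if i.val < p * q then col p n α r i else 0) else col p n α r i

/-- the column index of cut `g`: `(g / p) mod (R + 1)`. -/
def colIdx (n : ℕ) (g : Fin (n + 1)) : Fin (rk n + 1) := ⟨(g.val / p) % (rk n + 1), Nat.mod_lt _ (Nat.succ_pos _)⟩

/-- **the family `fieldY`**: cut `g` accepts `u` iff `g ≡ a_g · u (mod p)`, `a_g = fieldCoef (g/p) ((g/p) mod (R+1))`. -/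
noncomputable def fieldY (n : ℕ) (α : GaloisField p (rk n)) : Fin (n + 1) → (Fin n → Bool) → Bool := fun g u =>
  decide ((((g : ℕ) : ZMod p)) = ∑ i, if u i then fieldCoef p n α (g.val / p) (colIdx p n g) i else 0)

/-- the CANONICAL (junta-free) presentation of `fieldY`. -/
noncomputable def fieldData (n : ℕ) (α : GaloisField p (rk n)) : JLinData p n where
  J := fun _ => ∅
  a := fun g => fieldCoef p n α (g.val / p) (colIdx p n g)
  h := fun g _ s => decide ((((g : ℕ) : ZMod p)) = s)
  hJ := fun _ _ _ _ _ => rfl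

/-- the canonical presentation presents `fieldY`. -/
theorem fieldData_strat (n : ℕ) (α : GaloisField p (rk n)) : (fieldData p n α).strat = fieldY p n α := by
  funext g u
  rfl

/-- the canonical presentation is junta-free. -/
theorem fieldData_J (n : ℕ) (α : GaloisField p (rk n)) (g : Fin (n + 1)) : (fieldData p n α).J g = ∅ := rfl

/-- the prefix parameter of the full-pattern cut owning power column `r`: `j r ≡ r (mod R+1)`, `j r > sepM`. -/
def jcut (n : ℕ) (r : Fin (rk n)) : ℕ := (rk n + 1) * (NullDial.sepM p n / (rk n + 1) + 1) + r.val

omit hp in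
/-- `jcut r mod (R+1) = r`. -/
theorem jcut_mod (n : ℕ) (r : Fin (rk n)) : jcut p n r % (rk n + 1) = r.val := by
  unfold jcut
  rw [Nat.mul_add_mod, Nat.mod_eq_of_lt (Nat.lt_succ_of_lt r.isLt)]

omit hp in
/-- `sepM ≤ jcut r`. -/
theorem sepM_le_jcut (n : ℕ) (r : Fin (rk n)) : NullDial.sepM p n ≤ jcut p n r := by
  unfold jcut
  have h := Nat.lt_div_mul_add (a := NullDial.sepM p n) (b := rk n + 1) (by omega)
  rw [Nat.mul_add, mul_one, mul_comm]
  omega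

omit hp in
/-- the full-pattern cut fits: `p · jcut r ≤ n` once `3·p·(R+1) ≤ n`. -/
theorem p_jcut_le (n : ℕ) (hn : 3 * p * (rk n + 1) ≤ n) (r : Fin (rk n)) : p * jcut p n r ≤ n := by
  unfold jcut
  have h1 : (rk n + 1) * (NullDial.sepM p n / (rk n + 1)) ≤ NullDial.sepM p n := by rw [mul_comm]; exact Nat.div_mul_le_self _ _
  have h2 := NullDial.p_mul_sepM_le p n
  have h3 : p * ((rk n + 1) * (NullDial.sepM p n / (rk n + 1) + 1) + r.val) ≤ p * (NullDial.sepM p n + 2 * (rk n + 1)) := by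
    apply Nat.mul_le_mul_left
    have := r.isLt
    rw [Nat.mul_add, mul_one]
    omega
  have h4 : p * (NullDial.sepM p n + 2 * (rk n + 1)) = p * NullDial.sepM p n + 2 * (p * (rk n + 1)) := by ring
  have h5 : 3 * (n / 3) ≤ n := Nat.mul_div_le n 3
  have h6 : 3 * p * (rk n + 1) = 3 * (p * (rk n + 1)) := by ring
  omega

/-- the FULL-PATTERN CUT owning column `r`. -/
def gcut (n : ℕ) (hn : 3 * p * (rk n + 1) ≤ n) (r : Fin (rk n)) : Fin (n + 1) :=
  ⟨p * jcut p n r, Nat.lt_succ_of_le (p_jcut_le p n hn r)⟩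

/-- its prefix parameter is `jcut r`. -/
theorem gcut_div (n : ℕ) (hn : 3 * p * (rk n + 1) ≤ n) (r : Fin (rk n)) : (gcut p n hn r).val / p = jcut p n r := by
  show p * jcut p n r / p = jcut p n r
  exact Nat.mul_div_cancel_left _ hp.out.pos

/-- its column is the power column `r`. -/
theorem colIdx_gcut (n : ℕ) (hn : 3 * p * (rk n + 1) ≤ n) (r : Fin (rk n)) :
    colIdx p n (gcut p n hn r) = ⟨r.val, Nat.lt_succ_of_lt r.isLt⟩ := by
  ext
  show (gcut p n hn r).val / p % (rk n + 1) = r.val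
  rw [gcut_div, jcut_mod]

/-- its residue is `0`. -/
theorem gcut_cast (n : ℕ) (hn : 3 * p * (rk n + 1) ≤ n) (r : Fin (rk n)) : ((((gcut p n hn r : Fin (n + 1)) : ℕ) : ZMod p)) = 0 := by
  show (((p * jcut p n r : ℕ)) : ZMod p) = 0
  rw [Nat.cast_mul, ZMod.natCast_self, zero_mul]

/-- it is full-pattern: its canonical coefficients ARE the power column `r`. -/
theorem fieldCoef_gcut (n : ℕ) (hn : 3 * p * (rk n + 1) ≤ n) (α : GaloisField p (rk n)) (r : Fin (rk n)) (i : Fin n) :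
    fieldCoef p n α ((gcut p n hn r).val / p) (colIdx p n (gcut p n hn r)) i = pcol p n α r i := by
  rw [gcut_div, colIdx_gcut]
  unfold fieldCoef
  have h1 : p * NullDial.sepM p n ≤ p * jcut p n r := Nat.mul_le_mul_left _ (sepM_le_jcut p n r)
  rw [col_cast]
  split_ifs with ha hb
  · rfl
  · omega
  · rfl

/-- the strategy at a full-pattern cut is the `u = 0`-accepting test of the power column. -/
theorem fieldY_gcut (n : ℕ) (hn : 3 * p * (rk n + 1) ≤ n) (α : GaloisField p (rk n)) (r : Fin (rk n)) (u : Fin n → Bool) :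
    fieldY p n α (gcut p n hn r) u = decide ((0 : ZMod p) = ∑ i, if u i then pcol p n α r i else 0) := by
  unfold fieldY
  rw [gcut_cast]
  congr 1
  rw [Finset.sum_congr rfl fun i _ => by rw [fieldCoef_gcut]]

end Family

end Summit.QuantumAdvantage.AdviceFreeQNC0.JLinPeel.FieldCol
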